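import Summits.ValiantsHypothesis.ValiantsHypothesis.Theorems.FifoMatchingNNDivisionHardConePricing

/-!
# CONE PRICING on the zonotope chapter of COR-VIRTUAL (crux `NNDivisionHard`, stmt-ValiantsHypothesis-21181) — part 4/5 — §14 (C4) THE BALANCED FACE, zones: the functional `W_R` prices every zone of the size-matched `Z_cor`

Theorems-side port (val-port-1 g3, presser; declaration texts VERBATIM, one-line docstrings added where the gate lint wants them) of val-idea-44
g0's author-staged transplant `FifoMatchingNNDivisionHardConePricing.lean` (sha16 51fc894432d3ede5) of the crux workfile
`Cruxes/NNDivisionHard/ConePricing44.lean` rev 10 @0a2b2fead3a1 (W5-R2; critic of record val-idea-crit-9 g1: WAVE-5 LIST row (6) KEEP §G(3)+(4),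
ADDENDUM A4 SIG-FIRST GO 2026-08-28T22:04:39Z), split by the 400-line cap into five modules: `…ConePricing` (§2–§8) → `…Antitone` (§9–§11, §13)
→ `…Corona` (§12); `…ConePricing` → `…BalancedFaceZones` (§14, zones) → `…BalancedFace` (§14 theorem, §14b).  Statement-free (δ-unfolded `Prop`s).

* §14 (first half) `zCorSM` = val-idea-41's SIZE-MATCHED canonical covering candidate `Z_cor = Σ_{|A|=|B|≥1, A∩B=∅, A∪B≠[h]} [0,1]·(P_{A∪B} − P_B)`,
  the functional `wR` (`W_R = −2J_R + (𝟙_R𝟙_{Rᶜ}ᵀ + 𝟙_{Rᶜ}𝟙_Rᵀ) − (6|R|+1)·I_{Rᶜ}`), `qf_wR`, `face_ineq_aux`, and the push-forward bookkeeping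
  (`rhoR`, `rhoR'`, `uPush_rhoR_*`, `abs_sumU_le`).

HONEST LABEL: helper rows for an OPEN crux (21181 `NNDivisionHard` OPEN; COR-VIRTUAL / `CovZonoHard` OPEN); nothing here is a summit
statement; VP ≠ VNP is NOT proved.
-/

set_option autoImplicit false
-- the mandated summit-side namespace repeats a component by design (single-problem summit)
set_option linter.dupNamespace false

noncomputable section
open Matrix Finset
open scoped Pointwise

namespace Summit.ValiantsHypothesis.ValiantsHypothesis.Theorems.FifoMatching

namespace ConePricing

open Literature.Barriers.PneNP (HasEFOfSize)
open Literature.Combinatorics.Optimization (corPolytopeGraph corVec)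

variable {h : ℕ}

/-! ## 14. (C4) THE BALANCED FACE — 41's SIZE-MATCHED `Z_cor` is NOT budgeted (unconditional, kernel).
`Z_cor(h) = Σ [0,1]·g_{A,B}` over disjoint pairs with `|A| = |B| ≥ 1`, `A ∪ B ≠ [h]` (val-idea-41 rev 1.7 (E4.5)). For the block
`R = {p < n+1}` (`2n+3 ≤ h`) the functional `W_R = −2·J_R + (𝟙_R𝟙_{Rᶜ}ᵀ + 𝟙_{Rᶜ}𝟙_Rᵀ) − (6(n+1)+1)·I_{Rᶜ}` prices every zone
nonpositively — with `a = |A∩R|, a′ = |A∖R|, b = |B∩R|`: `⟨W_R, g_{A,B}⟩ = 4aa′ − 6ab + 2a′b − (6(n+1)+1)a′ ≤ −a′ − 6ab` — and is tight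
exactly on the zones `A ⊆ R, B ⊆ Rᶜ`, whose `R × R` blocks are the clique matrices `P_A`.  The BFPS functionals on the block plus `λ·W_R`
(`λ = (h(n+1))²`) then run the UDISJ pattern on `Z_cor` ITSELF: `3^n ≤ (xc+1)·2^n`, i.e. `xc(Z_cor(h)) ≥ 1.5^{⌊(h−3)/2⌋} − 1`.
(The size-matching is essential: on the unrestricted `Z'_cor` the term `2ab′` is unbounded, `W_R` is not in the polar, and §12 shows
the apex cone is cheap.) -/

/-- 41's size-matched corona zonotope `Z_cor(h) = Σ_{(A,B) size-matched admissible} [0,1]·g_{A,B}` (zones: `A ∩ B = ∅`, `|A| = |B| ≥ 1`, `A ∪ B ≠ [h]`). -/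
def zCorSM (h : ℕ) : Set (Fin h × Fin h → ℝ) :=
  {x | ∃ μ : Finset (Fin h) × Finset (Fin h) → ℝ, (∀ AB, 0 ≤ μ AB ∧ μ AB ≤ 1) ∧ (∀ AB, ¬ (Disjoint AB.1 AB.2 ∧ AB.1.card = AB.2.card ∧ 1 ≤ AB.1.card ∧ AB.1 ∪ AB.2 ≠ Finset.univ) → μ AB = 0) ∧
    x = ∑ AB, μ AB • coronaKernel AB.1 AB.2}


/-- the balanced-face functional `W_R` for the block `R = {p < m}`. -/
def wR (h m : ℕ) : Fin h × Fin h → ℝ := fun pq =>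
  if (pq.1 : ℕ) < m ∧ (pq.2 : ℕ) < m then -2
  else if (pq.1 : ℕ) < m ∨ (pq.2 : ℕ) < m then 1
  else if pq.1 = pq.2 then -(6 * (m : ℝ) + 1) else 0

/-- block counts `|S ∩ R|`, `|S ∖ R|` as reals. -/
def cR (m : ℕ) (S : Finset (Fin h)) : ℝ := ((S.filter fun p : Fin h => (p : ℕ) < m).card : ℝ)
/-- the number of elements of `S` outside the first `m` coordinates (as a real). -/
def cS (m : ℕ) (S : Finset (Fin h)) : ℝ := ((S.filter fun p : Fin h => ¬ (p : ℕ) < m).card : ℝ)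

/-- `cR m` is additive on disjoint unions. -/
theorem cR_union (m : ℕ) {A B : Finset (Fin h)} (hAB : Disjoint A B) : cR m (A ∪ B) = cR m A + cR m B := by
  unfold cR
  rw [Finset.filter_union, Finset.card_union_of_disjoint (Finset.disjoint_filter_filter hAB)]
  push_cast; rfl

/-- `cS m` is additive on disjoint unions. -/
theorem cS_union (m : ℕ) {A B : Finset (Fin h)} (hAB : Disjoint A B) : cS m (A ∪ B) = cS m A + cS m B := by
  unfold cS
  rw [Finset.filter_union, Finset.card_union_of_disjoint (Finset.disjoint_filter_filter hAB)]
  push_cast; rfl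

/-- `cR m S + cS m S = |S|`. -/
theorem cR_add_cS (m : ℕ) (S : Finset (Fin h)) : cR m S + cS m S = S.card := by
  unfold cR cS
  exact_mod_cast Finset.card_filter_add_card_filter_not (fun p : Fin h => (p : ℕ) < m)

/-- `cR m S ≤ m`. -/
theorem cR_le (m : ℕ) (S : Finset (Fin h)) : cR m S ≤ m := by
  unfold cR
  have : (S.filter fun p : Fin h => (p : ℕ) < m).card ≤ (Finset.range m).card :=
    Finset.card_le_card_of_injOn (fun p : Fin h => (p : ℕ))
      (fun p hp => Finset.mem_range.mpr (Finset.mem_filter.mp hp).2)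
      (Fin.val_injective.injOn)
  rw [Finset.card_range] at this
  exact_mod_cast this

/-- `q_{W_R}(S) = −2|S∩R|² + 2|S∩R||S∖R| − (6m+1)|S∖R|`. -/
theorem qf_wR (m : ℕ) (S : Finset (Fin h)) :
    qf (wR h m) S = -2 * cR m S ^ 2 + 2 * cR m S * cS m S - (6 * (m : ℝ) + 1) * cS m S := by
  classical
  have inner₁ : ∀ x : Fin h, (x : ℕ) < m → ∑ y ∈ S, wR h m (x, y) = -2 * cR m S + cS m S := by
    intro x hx
    rw [← Finset.sum_filter_add_sum_filter_not S (fun p : Fin h => (p : ℕ) < m)]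
    have e1 : ∀ y ∈ S.filter (fun p : Fin h => (p : ℕ) < m), wR h m (x, y) = -2 := by
      intro y hy; rw [Finset.mem_filter] at hy; simp [wR, hx, hy.2]
    have e2 : ∀ y ∈ S.filter (fun p : Fin h => ¬ (p : ℕ) < m), wR h m (x, y) = 1 := by
      intro y hy; rw [Finset.mem_filter] at hy; simp [wR, hx, hy.2]
    rw [Finset.sum_congr rfl e1, Finset.sum_congr rfl e2, Finset.sum_const, Finset.sum_const]
    simp only [nsmul_eq_mul, cR, cS]; ring
  have inner₂ : ∀ x ∈ S, ¬ (x : ℕ) < m → ∑ y ∈ S, wR h m (x, y) = cR m S - (6 * (m : ℝ) + 1) := by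
    intro x hxS hx
    rw [← Finset.sum_filter_add_sum_filter_not S (fun p : Fin h => (p : ℕ) < m)]
    have e1 : ∀ y ∈ S.filter (fun p : Fin h => (p : ℕ) < m), wR h m (x, y) = 1 := by
      intro y hy; rw [Finset.mem_filter] at hy; simp [wR, hx, hy.2]
    have e2 : ∀ y ∈ S.filter (fun p : Fin h => ¬ (p : ℕ) < m), wR h m (x, y) = if x = y then -(6 * (m : ℝ) + 1) else 0 := by
      intro y hy; rw [Finset.mem_filter] at hy; simp [wR, hx, hy.2]
    have hx' : x ∈ S.filter (fun p : Fin h => ¬ (p : ℕ) < m) := Finset.mem_filter.mpr ⟨hxS, hx⟩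
    rw [Finset.sum_congr rfl e1, Finset.sum_congr rfl e2, Finset.sum_const, Finset.sum_ite_eq, if_pos hx']
    simp only [nsmul_eq_mul, cR]; ring
  unfold qf
  rw [← Finset.sum_filter_add_sum_filter_not S (fun p : Fin h => (p : ℕ) < m)]
  have o1 : ∀ x ∈ S.filter (fun p : Fin h => (p : ℕ) < m), ∑ y ∈ S, wR h m (x, y) = -2 * cR m S + cS m S :=
    fun x hx => inner₁ x (Finset.mem_filter.mp hx).2
  have o2 : ∀ x ∈ S.filter (fun p : Fin h => ¬ (p : ℕ) < m), ∑ y ∈ S, wR h m (x, y) = cR m S - (6 * (m : ℝ) + 1) :=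
    fun x hx => inner₂ x (Finset.mem_filter.mp hx).1 (Finset.mem_filter.mp hx).2
  rw [Finset.sum_congr rfl o1, Finset.sum_congr rfl o2, Finset.sum_const, Finset.sum_const]
  simp only [nsmul_eq_mul, cR, cS]; ring

/-- the sign lemma: with `|A| = |B|`, `⟨W_R, g_{A,B}⟩ ≤ −|A∖R| − 6|A∩R||B∩R|`. -/
theorem face_ineq_aux (M aR aS bR bS : ℝ) (haS : 0 ≤ aS) (hsz : aR + aS = bR + bS) (haR : aR ≤ M) (hbR : bR ≤ M) :
    (-2 * (aR + bR) ^ 2 + 2 * (aR + bR) * (aS + bS) - (6 * M + 1) * (aS + bS))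
      - (-2 * bR ^ 2 + 2 * bR * bS - (6 * M + 1) * bS) ≤ -aS - 6 * (aR * bR) := by
  have hbS : bS = aR + aS - bR := by linarith
  subst hbS
  nlinarith [mul_nonneg haS (sub_nonneg.2 haR), mul_nonneg haS (sub_nonneg.2 hbR)]

/-- `∑_p w_p·χ_{ind S}(p) = ∑_{p ∈ S} w_p`. -/
theorem sum_mul_chi_ind (w : Fin h → ℝ) (S : Finset (Fin h)) : ∑ p, w p * chi (ind S) p = ∑ p ∈ S, w p := by
  classical
  simp only [chi_ind, mul_ite, mul_one, mul_zero]
  rw [Finset.sum_ite_mem, Finset.univ_inter]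

/-- a negative rank-one functional on a corona kernel: `−(Σ_{A∪B} w)² + (Σ_B w)²`. -/
theorem negRankOne_dot_coronaKernel (w : Fin h → ℝ) (A B : Finset (Fin h)) :
    (fun x : Fin h × Fin h => -(w x.1 * w x.2)) ⬝ᵥ coronaKernel A B = -((∑ p ∈ A ∪ B, w p) ^ 2) + (∑ p ∈ B, w p) ^ 2 := by
  rw [coronaKernel, dotProduct_sub, negRankOne_dot_corVec, negRankOne_dot_corVec, sum_mul_chi_ind, sum_mul_chi_ind]
  ring

/-- the block embedding `R = {p < n+1} ⊂ [h]`. -/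
def rhoR (n h : ℕ) (hm : n + 1 ≤ h) : Fin (n + 1) ↪ Fin h := Fin.castLEEmb hm

/-- values of the block embedding `rhoR`: `rhoR n h hm i = i`. -/
@[simp] theorem rhoR_val (n h : ℕ) (hm : n + 1 ≤ h) (i : Fin (n + 1)) : ((rhoR n h hm i : Fin h) : ℕ) = i := rfl

/-- the partner block `{n+1 ≤ p < 2n+2}` (where the `B`'s of the selected zones live). -/
def rhoR' (n h : ℕ) (hh : 2 * n + 2 ≤ h) : Fin (n + 1) ↪ Fin h :=
  ⟨fun i => ⟨n + 1 + i, by omega⟩, fun i j hij => Fin.ext (by have := congrArg Fin.val hij; dsimp only at this; omega)⟩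

/-- values of the partner-block embedding `rhoR'`: `rhoR' n h hh i = n + 1 + i`. -/
@[simp] theorem rhoR'_val (n h : ℕ) (hh : 2 * n + 2 ≤ h) (i : Fin (n + 1)) : ((rhoR' n h hh i : Fin h) : ℕ) = n + 1 + i := rfl

/-- the pushed vector `uPush (rhoR n h hm) a` vanishes off the first `n + 1` coordinates. -/
theorem uPush_rhoR_offblock (n h : ℕ) (hm : n + 1 ≤ h) (a : Finset (Fin n)) (p : Fin h) (hp : ¬ (p : ℕ) < n + 1) :
    uPush (rhoR n h hm) a p = 0 := by
  unfold uPush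
  refine Finset.sum_eq_zero fun i _ => ?_
  rw [if_neg]
  intro hi
  apply hp
  rw [← hi, rhoR_val]
  exact i.isLt

/-- the pushed vector `uPush (rhoR n h hm) a` agrees with `uVec a` on the first `n + 1` coordinates. -/
theorem uPush_rhoR_at (n h : ℕ) (hm : n + 1 ≤ h) (a : Finset (Fin n)) (i : Fin (n + 1)) :
    uPush (rhoR n h hm) a (rhoR n h hm i) = uVec a i := by
  classical
  unfold uPush
  have : ∀ j : Fin (n + 1), (if rhoR n h hm j = rhoR n h hm i then uVec a j else 0) = if j = i then uVec a j else 0 := by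
    intro j; simp only [(rhoR n h hm).injective.eq_iff]
  rw [Finset.sum_congr rfl fun j _ => this j, Finset.sum_ite_eq']
  simp

/-- the pushed vector sums to `0` over any set avoiding the first `n + 1` coordinates. -/
theorem sumU_offblock (n h : ℕ) (hm : n + 1 ≤ h) (a : Finset (Fin n)) (S : Finset (Fin h))
    (hS : ∀ p ∈ S, ¬ (p : ℕ) < n + 1) : ∑ p ∈ S, uPush (rhoR n h hm) a p = 0 :=
  Finset.sum_eq_zero fun p hp => uPush_rhoR_offblock n h hm a p (hS p hp)

/-- `cR (n + 1) S = 0` means `S` avoids the first `n + 1` coordinates. -/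
theorem offblock_of_cR_eq_zero (n : ℕ) (S : Finset (Fin h)) (h0 : cR (n + 1) S = 0) : ∀ p ∈ S, ¬ (p : ℕ) < n + 1 := by
  unfold cR at h0
  have : (S.filter fun p : Fin h => (p : ℕ) < n + 1) = ∅ := Finset.card_eq_zero.mp (by exact_mod_cast h0)
  intro p hp hlt
  have hmem : p ∈ (S.filter fun p : Fin h => (p : ℕ) < n + 1) := Finset.mem_filter.mpr ⟨hp, hlt⟩
  rw [this] at hmem
  simp at hmem

/-- `|uVec a i| ≤ 1`. -/
theorem abs_uVec_le {n : ℕ} (a : Finset (Fin n)) (i : Fin (n + 1)) : |uVec a i| ≤ 1 := by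
  unfold uVec
  refine Fin.cases ?_ (fun j => ?_) i
  · simp
  · simp only [Fin.cons_succ]; split_ifs <;> simp

/-- `|uPush ρ a p| ≤ n + 1`. -/
theorem abs_uPush_le {n h : ℕ} (ρ : Fin (n + 1) ↪ Fin h) (a : Finset (Fin n)) (p : Fin h) : |uPush ρ a p| ≤ (n : ℝ) + 1 := by
  unfold uPush
  refine (Finset.abs_sum_le_sum_abs _ _).trans ?_
  have : ∀ i ∈ (Finset.univ : Finset (Fin (n + 1))), |(if ρ i = p then uVec a i else 0)| ≤ (1 : ℝ) := by
    intro i _; split_ifs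
    · exact abs_uVec_le a i
    · simp
  refine (Finset.sum_le_sum this).trans ?_
  simp

/-- `|∑_{p ∈ S} uPush ρ a p| ≤ h·(n + 1)`. -/
theorem abs_sumU_le {n h : ℕ} (ρ : Fin (n + 1) ↪ Fin h) (a : Finset (Fin n)) (S : Finset (Fin h)) :
    |∑ p ∈ S, uPush ρ a p| ≤ (h : ℝ) * ((n : ℝ) + 1) := by
  refine (Finset.abs_sum_le_sum_abs _ _).trans ?_
  refine (Finset.sum_le_sum fun p _ => abs_uPush_le ρ a p).trans ?_
  rw [Finset.sum_const, nsmul_eq_mul]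
  have hS : (S.card : ℝ) ≤ h := by exact_mod_cast (Finset.card_le_univ S).trans_eq (Fintype.card_fin h)
  have hn : (0 : ℝ) ≤ (n : ℝ) + 1 := by positivity
  exact mul_le_mul_of_nonneg_right hS hn

end ConePricing

end Summit.ValiantsHypothesis.ValiantsHypothesis.Theorems.FifoMatching

end
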